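import Mathlib
import Literature.Combinatorics.Additive.TripleProductProperty
import Summits.MatrixMultiplication.MatrixMultiplication.Theses.SnSubsetDichotomy
import Summits.MatrixMultiplication.MatrixMultiplication.Theorems.SnSubsetDichotomyThresholdSubsetTriplesStubCayleyDeletion
import Summits.MatrixMultiplication.MatrixMultiplication.Theorems.SnSubsetDichotomyThresholdSubsetTriplesStubTwistFreeOfBlocked
import Summits.MatrixMultiplication.MatrixMultiplication.Theorems.SnSubsetDichotomyThresholdSubsetTriplesStubTppOfTwistFree
import Summits.MatrixMultiplication.MatrixMultiplication.Theorems.SnSubsetDichotomyThresholdSubsetTriplesStubCubeThreshold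

/-!
# Crux `SnSubsetDichotomy.ThresholdSubsetTriples` (stmt-MatrixMultiplication-10882) — the ℤ/3-symmetric residual
# `C⁺` of the gen-1 lines, stated definition-free, with its two bridges

Line lead c2 (2026-08-17), `--supports` helper.  Every gen-1 line of this crux (`interleaved-subsignature-ascent`,
`triality-uniquely-cubing-translate`, `Sketch`, `SketchIdeator2`) is dead or reduces to ONE statement, here called the
**symmetric threshold** `C⁺` (a.k.a. `TrialityThreshold`, crux workfile `Disproof.lean` §8; BCCGU 2017 §4, the
ℤ/3-symmetric half of the open question): for every `c > 0`, cofinally in `n`, an element `τ ∈ S_n` with `τ³ = 1` and ONE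
set `X ⊆ S_n` whose twisted corner equation `x₁x₁'⁻¹ τ (x₂x₂'⁻¹) τ (x₃x₃'⁻¹) τ = 1` has only trivial solutions in `X`
(equivalently `TPP(X, τXτ⁻¹, τ²Xτ⁻²)`, tree `stub_tpp_of_twistFree`) and `|X| > √(n!)·e^{-c√n}`.

* `thresholdSubsetTriples_of_symmetricThreshold` — `C⁺ → X` (the crux), by `stub_tpp_of_twistFree` (p85977) and
  `stub_cubeThreshold` (p86006) at `c/3`.
* `symmetricThreshold_iff_blockedHosts` — `C⁺` is EQUIVALENT, at the same scale `c`, to the one open stub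
  `stub_blockedHosts` of line `SketchIdeator2` (blocked hosts `K` with bad-quotient set `B` and
  `|K| > (2|B|+1)·√(n!)e^{-c√n}`): `→` with `K := X`, `B := ∅`; `←` by greedy Cayley deletion `stub_cayleyDeletion`
  (p85947) and `stub_twistFree_of_blocked` (p85948).  So the blocking set is cosmetic and the stub is the crux on
  ℤ/3-symmetric witnesses — the statement the lead hands back as crux-sized (`promote-stub`).

Both statements are written out in full (no new definitions), so a planner can file `C⁺` verbatim as an item.
References: Blasiak–Church–Cohn–Grochow–Umans 2017 (arXiv:1712.02302) §4; Cohn–Umans 2003 Def. 2.1; siege certificates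
k3/k7/k9/k13/k24 on this crux item (same equivalence, not landed); lead census `Census-c5/c6`.
-/

-- the tree's namespace `Summit.MatrixMultiplication.MatrixMultiplication.…` repeats a component by design
set_option linter.dupNamespace false

namespace Summit.MatrixMultiplication.MatrixMultiplication.Theorems.ThresholdSubsetTriples

open Literature.Combinatorics.Additive

/-- Conjugation `x ↦ g x g⁻¹` is injective (used to count the conjugate copies `τXτ⁻¹`, `τ²Xτ⁻²`). -/
theorem conj_left_right_injective {G : Type*} [Group G] (g : G) :
    Function.Injective (fun x : G => g * x * g⁻¹) := by
  intro a b h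
  simpa using h

/-- **`C⁺ → X`.**  A symmetric threshold family gives threshold TPP subset triples `(X, τXτ⁻¹, τ²Xτ⁻²)`:
twisted-corner-free at scale `c/3` ⇒ TPP (`stub_tpp_of_twistFree`) with volume `|X|³ > (n!)^{3/2}e^{-c√n}`
(`stub_cubeThreshold`). -/
theorem thresholdSubsetTriples_of_symmetricThreshold (h : ∀ c : ℝ, 0 < c → ∀ n₀ : ℕ, ∃ n ≥ n₀, ∃ τ : Equiv.Perm (Fin n), τ ^ 3 = 1 ∧ ∃ X : Finset (Equiv.Perm (Fin n)), (∀ x₁ ∈ X, ∀ x₁' ∈ X, ∀ x₂ ∈ X, ∀ x₂' ∈ X, ∀ x₃ ∈ X, ∀ x₃' ∈ X, x₁ * x₁'⁻¹ * τ * (x₂ * x₂'⁻¹) * τ * (x₃ * x₃'⁻¹) * τ = 1 → x₁ = x₁' ∧ x₂ = x₂' ∧ x₃ = x₃') ∧ Real.sqrt (n.factorial : ℝ) * Real.exp (-(c * Real.sqrt (n : ℝ))) < (X.card : ℝ)) : Summit.MatrixMultiplication.MatrixMultiplication.Theses.SnSubsetDichotomy.ThresholdSubsetTriples := by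
  intro c hc n₀
  obtain ⟨n, hn, τ, hτ, X, htw, hbig⟩ := h (c / 3) (by positivity) n₀
  refine ⟨n, hn, X, X.image (fun x => τ * x * τ⁻¹), X.image (fun x => τ ^ 2 * x * (τ ^ 2)⁻¹),
    stub_tpp_of_twistFree n τ X hτ htw, ?_⟩
  rw [Finset.card_image_of_injective _ (conj_left_right_injective _),
    Finset.card_image_of_injective _ (conj_left_right_injective _)]
  exact stub_cubeThreshold c n X.card hbig

/-- **`C⁺ ⟺ stub_blockedHosts`** (line `SketchIdeator2`'s one open stub), at the same scale `c`.
`→`: take the host `K := X` and no blocked quotients `B := ∅`.  `←`: greedy Cayley deletion (`stub_cayleyDeletion`)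
extracts `X ⊆ K` avoiding `B` as a quotient with `|K| ≤ (2|B|+1)|X|`, and `X` is twisted-corner-free
(`stub_twistFree_of_blocked`); the factor `2|B|+1` cancels exactly. -/
theorem symmetricThreshold_iff_blockedHosts : (∀ c : ℝ, 0 < c → ∀ n₀ : ℕ, ∃ n ≥ n₀, ∃ τ : Equiv.Perm (Fin n), τ ^ 3 = 1 ∧ ∃ X : Finset (Equiv.Perm (Fin n)), (∀ x₁ ∈ X, ∀ x₁' ∈ X, ∀ x₂ ∈ X, ∀ x₂' ∈ X, ∀ x₃ ∈ X, ∀ x₃' ∈ X, x₁ * x₁'⁻¹ * τ * (x₂ * x₂'⁻¹) * τ * (x₃ * x₃'⁻¹) * τ = 1 → x₁ = x₁' ∧ x₂ = x₂' ∧ x₃ = x₃') ∧ Real.sqrt (n.factorial : ℝ) * Real.exp (-(c * Real.sqrt (n : ℝ))) < (X.card : ℝ)) ↔ (∀ c : ℝ, 0 < c → ∀ n₀ : ℕ, ∃ n ≥ n₀, ∃ τ : Equiv.Perm (Fin n), τ ^ 3 = 1 ∧ ∃ K B : Finset (Equiv.Perm (Fin n)), (∀ x₁ ∈ K, ∀ x₁'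 ∈ K, ∀ x₂ ∈ K, ∀ x₂' ∈ K, ∀ x₃ ∈ K, ∀ x₃' ∈ K, x₁ * x₁'⁻¹ * τ * (x₂ * x₂'⁻¹) * τ * (x₃ * x₃'⁻¹) * τ = 1 → (x₁ = x₁' ∧ x₂ = x₂' ∧ x₃ = x₃') ∨ (x₁ * x₁'⁻¹ ∈ B ∧ x₁ ≠ x₁') ∨ (x₂ * x₂'⁻¹ ∈ B ∧ x₂ ≠ x₂') ∨ (x₃ * x₃'⁻¹ ∈ B ∧ x₃ ≠ x₃')) ∧ ((2 * B.card + 1 : ℕ) : ℝ) * (Real.sqrt (n.factorial : ℝ) * Real.exp (-(c * Real.sqrt (n : ℝ)))) < (K.card : ℝ)) := by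
  constructor
  · intro h c hc n₀
    obtain ⟨n, hn, τ, hτ, X, htw, hbig⟩ := h c hc n₀
    refine ⟨n, hn, τ, hτ, X, ∅, ?_, ?_⟩
    · intro x₁ h₁ x₁' h₁' x₂ h₂ x₂' h₂' x₃ h₃ x₃' h₃' heq
      exact Or.inl (htw x₁ h₁ x₁' h₁' x₂ h₂ x₂' h₂' x₃ h₃ x₃' h₃' heq)
    · simpa using hbig
  · intro h c hc n₀
    obtain ⟨n, hn, τ, hτ, K, B, hBl, hbig⟩ := h c hc n₀
    obtain ⟨X, hXK, hA, hcard⟩ := stub_cayleyDeletion n K B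
    refine ⟨n, hn, τ, hτ, X, stub_twistFree_of_blocked n τ K B X hXK hBl hA, ?_⟩
    have hpos : (0 : ℝ) < ((2 * B.card + 1 : ℕ) : ℝ) := by positivity
    have hKX : (K.card : ℝ) ≤ ((2 * B.card + 1 : ℕ) : ℝ) * (X.card : ℝ) := by exact_mod_cast hcard
    exact lt_of_mul_lt_mul_left (lt_of_lt_of_le hbig hKX) hpos.le

end Summit.MatrixMultiplication.MatrixMultiplication.Theorems.ThresholdSubsetTriples
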